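/-
Copyright (c) 2026 the pub-hodgecm-mathlib formalisation cell (harness21).  Prover seat hodgecm-mathlib-K2E4-p23 (g2), Track B ∕ K2-LIT, h413 =
`stmt-HodgeConjecture-24833`, ENGINE E1, 5Res campaign «ENDGAME BY FAMILIES», ROADCARD §3′ (M2 v2), deal (239)(α) of K2E1-plan (g7): the `hline` payer of ★ D5′ proper —
level sets of a non-constant holomorphic symbol along a real line are Lebesgue-null.  Mathlib-only.
-/
import Mathlib.Analysis.Analytic.IsolatedZeros
import Mathlib.Analysis.Analytic.Constructions
import Mathlib.Analysis.Analytic.Linear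
import Mathlib.Analysis.Complex.Basic
import Mathlib.MeasureTheory.Topology
import Mathlib.MeasureTheory.Measure.Lebesgue.Basic
import Mathlib.MeasureTheory.Constructions.BorelSpace.Complex
import HarnessLib

/-!
# K2·E1 — `K2E1AnalyticLevelSetNullU`: LEVEL SETS OF A NON-CONSTANT HOLOMORPHIC FUNCTION ALONG A REAL LINE ARE LEBESGUE-NULL
# (ROADCARD §3′ D5′ — the `hline` payer of ★ `K2E1IrreducibleNoContinuousSpectrumU`; Mathlib-only)

Track B ∕ K2-LIT, crux h413 = `stmt-HodgeConjecture-24833`, route of record `HCCMUnconditional`; cell `hodgecm-mathlib`, squad K2, ENGINE E1 (5Res campaign, M2 v2 §3′.1 (iii′)).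
Prover seat `hodgecm-mathlib-K2E4-p23` (g2); deal (239)(α).  THEOREMS ONLY (no `def`, no `instance`, no notation, no named-fact hypothesis, no `sorry`); Mathlib-only; lane
`--supports stmt-HodgeConjecture-24833 --as helper` (count-neutral).  CLOSES NO SOCKET.

THE STATEMENT.  `s : ℂ → ℂ` analytic on a preconnected `Ω` containing the real line `t ↦ z₀ + t·d` (`d ≠ 0`; E1: the unitary axis `½ + i(· + t_w)`, the symbol `s_h(z) = ĥ_∞(z)` of an
arch-central Hecke operator, entire by ★ 2a ∕ ★ 12d-C), NOT CONSTANT on `Ω` (E1: ★ p860148 `exists_apply_ne_apply_of_secondDiff`, ★ D3): THEN for every `c`,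
**`volume {t : ℝ | s (z₀ + t·d) = c} = 0`** (`volume_levelSet_line_eq_zero`).  PROOF: `t ↦ s(z₀ + t d) − c` is real-analytic on `ℝ`; if it vanished identically, the identity theorem over `ℂ`
at `z₀` (the line accumulates there) would make `s ≡ c` on `Ω`; otherwise its zero set is codiscrete-complemented (Mathlib `AnalyticOnNhd.eqOn_or_eventually_ne_of_preconnected`), hence
Lebesgue-null (Mathlib `ae_restrict_le_codiscreteWithin`).
* §1 `analyticOnNhd_comp_line`, `frequently_line_nhdsWithin`, `eqOn_const_of_forall_line` (constancy on the line ⇒ constancy on `Ω`), **`volume_levelSet_line_eq_zero`**, and the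
  unitary-axis print **`volume_levelSet_axis_eq_zero`** (`z₀ = ½ + i t_w`, `d = i`).
* §2 the reductions ★ D5′'s `hline` wants: `measure_inter_setOf_forall_eq_zero_of_exists` (ONE symbol with null level set suffices for the joint level set), `map_levelSet_eq_zero` (push-forward
  along a measurable line), `sum_levelSet_eq_zero` (countably many lines, `Measure.sum`).
HONEST LABEL: HC_CM is proved only modulo the 7 printed citations (2 remaining named inputs: hLiu418 = `stmt-HodgeConjecture-24832`, h413 = `stmt-HodgeConjecture-24833`) until rung 0
closes; this file asserts no named fact and closes no socket; count-neutral.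

## References
* [Conway1978] J. B. Conway, *Functions of One Complex Variable* (2nd ed., 1978), IV §3 (identity theorem, isolated zeros).
* [ReedSimonI1980] M. Reed, B. Simon, *Methods of Modern Mathematical Physics I* (1980), §VII.2 (spectral measures; null level sets of multipliers).
-/

set_option autoImplicit false
-- the mandated namespace repeats the single-problem summit's segment (`HodgeConjecture.HodgeConjecture`)
set_option linter.dupNamespace false

noncomputable section

open MeasureTheory Set Filter Topology

namespace Summit.HodgeConjecture.HodgeConjecture.Cruxes.H413.K2E1AnalyticLevelSetNullU

/-! ## §1 Along a real line a non-constant holomorphic function has Lebesgue-null level sets -/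

/-- The restriction of an analytic `s` to the real line `t ↦ z₀ + t·d` (inside the domain of analyticity) is real-analytic on `ℝ`. [cite: Conway1978, IV §3] -/
theorem analyticOnNhd_comp_line {s : ℂ → ℂ} {Ω : Set ℂ} (hs : AnalyticOnNhd ℂ s Ω) (z₀ d : ℂ) (hline : ∀ t : ℝ, z₀ + (t : ℂ) * d ∈ Ω) :
    AnalyticOnNhd ℝ (fun t : ℝ => s (z₀ + (t : ℂ) * d)) univ := by
  intro t _
  have hℓ : AnalyticAt ℝ (fun t : ℝ => z₀ + (t : ℂ) * d) t :=
    analyticAt_const.add (((Complex.ofRealCLM.analyticAt t).congr (Eventually.of_forall fun x => rfl)).mul analyticAt_const)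
  exact AnalyticAt.comp (g := s) (f := fun t : ℝ => z₀ + (t : ℂ) * d) ((hs _ (hline t)).restrictScalars (𝕜 := ℝ)) hℓ

/-- The line accumulates at `z₀` inside the punctured neighbourhood filter: properties holding for all `t ≠ 0` near `0` hold frequently on `𝓝[≠] z₀` (`d ≠ 0`). [folklore] -/
theorem frequently_line_nhdsWithin (z₀ d : ℂ) (hd : d ≠ 0) {p : ℂ → Prop} (hp : ∀ t : ℝ, t ≠ 0 → p (z₀ + (t : ℂ) * d)) :
    ∃ᶠ z in 𝓝[≠] z₀, p z := by
  have hcont : Continuous fun t : ℝ => z₀ + (t : ℂ) * d := continuous_const.add (Complex.continuous_ofReal.mul continuous_const)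
  have htend : Tendsto (fun t : ℝ => z₀ + (t : ℂ) * d) (𝓝[≠] 0) (𝓝[≠] z₀) := by
    rw [tendsto_nhdsWithin_iff]
    refine ⟨?_, ?_⟩
    · have h : Tendsto (fun t : ℝ => z₀ + (t : ℂ) * d) (𝓝 0) (𝓝 (z₀ + ((0 : ℝ) : ℂ) * d)) := hcont.tendsto 0
      rw [Complex.ofReal_zero, zero_mul, add_zero] at h
      exact h.mono_left nhdsWithin_le_nhds
    · filter_upwards [self_mem_nhdsWithin] with t ht
      simp only [mem_compl_iff, mem_singleton_iff, add_eq_left, mul_eq_zero, Complex.ofReal_eq_zero, not_or]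
      exact ⟨ht, hd⟩
  have hfreq : ∃ᶠ t in 𝓝[≠] (0 : ℝ), t ≠ 0 := Eventually.frequently self_mem_nhdsWithin
  exact htend.frequently_map _ (fun t ht => hp t ht) hfreq

/-- **CONSTANT ON THE LINE ⇒ CONSTANT ON `Ω`** (identity theorem at `z₀`). [cite: Conway1978, IV §3] -/
theorem eqOn_const_of_forall_line {s : ℂ → ℂ} {Ω : Set ℂ} (hΩ : IsPreconnected Ω) (hs : AnalyticOnNhd ℂ s Ω) (z₀ d : ℂ) (hd : d ≠ 0)
    (hline : ∀ t : ℝ, z₀ + (t : ℂ) * d ∈ Ω) {c : ℂ} (hc : ∀ t : ℝ, s (z₀ + (t : ℂ) * d) = c) : EqOn s (fun _ => c) Ω := by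
  have hz₀ : z₀ ∈ Ω := by simpa using hline 0
  exact hs.eqOn_of_preconnected_of_frequently_eq analyticOnNhd_const hΩ hz₀ (frequently_line_nhdsWithin z₀ d hd fun t _ => hc t)

/-- **LEVEL SETS ALONG A LINE ARE NULL**: `s` analytic on the preconnected `Ω ⊇ {z₀ + t·d}` (`d ≠ 0`) and not constant on `Ω` ⇒ `volume {t : ℝ | s (z₀ + t·d) = c} = 0` for every `c`.
[cite: Conway1978, IV §3] [cite: ReedSimonI1980, §VII.2] -/
theorem volume_levelSet_line_eq_zero {s : ℂ → ℂ} {Ω : Set ℂ} (hΩ : IsPreconnected Ω) (hs : AnalyticOnNhd ℂ s Ω) (z₀ d : ℂ) (hd : d ≠ 0)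
    (hline : ∀ t : ℝ, z₀ + (t : ℂ) * d ∈ Ω) (hnc : ∃ z ∈ Ω, ∃ z' ∈ Ω, s z ≠ s z') (c : ℂ) :
    volume {t : ℝ | s (z₀ + (t : ℂ) * d) = c} = 0 := by
  rcases (analyticOnNhd_comp_line hs z₀ d hline).eqOn_or_eventually_ne_of_preconnected analyticOnNhd_const isPreconnected_univ (g := fun _ => c) with h | h
  · -- constant on the line ⇒ constant on Ω: contradiction
    exfalso
    obtain ⟨z, hz, z', hz', hne⟩ := hnc
    have hconst := eqOn_const_of_forall_line hΩ hs z₀ d hd hline fun t => h (mem_univ t)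
    exact hne ((hconst hz).trans (hconst hz').symm)
  · -- `{t | φ t ≠ c}` is codiscrete, hence conull
    have hae : {t : ℝ | s (z₀ + (t : ℂ) * d) ≠ c} ∈ ae (volume.restrict (univ : Set ℝ)) :=
      ae_restrict_le_codiscreteWithin MeasurableSet.univ h
    rw [Measure.restrict_univ, mem_ae_iff] at hae
    simpa only [compl_setOf, not_not] using hae

/-- **UNITARY-AXIS PRINT**: for `s` analytic and non-constant on a preconnected `Ω` containing the vertical line `re = ½` through `½ + i·t₀`: `volume {y : ℝ | s (½ + (y + t₀)·i) = c} = 0`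
(the line `z₀ = ½ + i t₀`, `d = i`; E1: `t₀ = t_w(χ)`, `s = ĥ_∞`). [cite: ReedSimonI1980, §VII.2] -/
theorem volume_levelSet_axis_eq_zero {s : ℂ → ℂ} {Ω : Set ℂ} (hΩ : IsPreconnected Ω) (hs : AnalyticOnNhd ℂ s Ω) (t₀ : ℝ)
    (hline : ∀ y : ℝ, (1 / 2 : ℂ) + ((y + t₀ : ℝ) : ℂ) * Complex.I ∈ Ω) (hnc : ∃ z ∈ Ω, ∃ z' ∈ Ω, s z ≠ s z') (c : ℂ) :
    volume {y : ℝ | s ((1 / 2 : ℂ) + ((y + t₀ : ℝ) : ℂ) * Complex.I) = c} = 0 := by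
  have hline' : ∀ t : ℝ, ((1 / 2 : ℂ) + (t₀ : ℂ) * Complex.I) + (t : ℂ) * Complex.I ∈ Ω := fun t => by
    have h := hline t; push_cast at h ⊢; ring_nf at h ⊢; exact h
  have h := volume_levelSet_line_eq_zero hΩ hs ((1 / 2 : ℂ) + (t₀ : ℂ) * Complex.I) Complex.I Complex.I_ne_zero hline' hnc c
  have hset : {y : ℝ | s ((1 / 2 : ℂ) + ((y + t₀ : ℝ) : ℂ) * Complex.I) = c} = {t : ℝ | s ((1 / 2 : ℂ) + (t₀ : ℂ) * Complex.I + (t : ℂ) * Complex.I) = c} := by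
    ext y
    simp only [mem_setOf_eq]
    push_cast
    ring_nf
  rw [hset, h]

/-! ## §2 The reductions used by ★ D5′ (`hline` shape `m (Λ ∩ {∀ j, s j = c j}) = 0`) -/

/-- **ONE SYMBOL SUFFICES**: if for some `j₀` the level set `{s j₀ = c j₀}` is `m`-null on `Λ`, so is the joint level set. [folklore] -/
theorem measure_inter_setOf_forall_eq_zero_of_exists {X : Type*} [MeasurableSpace X] (m : Measure X) {J : Type*} (s : J → X → ℂ) (c : J → ℂ) (Λ : Set X)
    (h : ∃ j₀, m (Λ ∩ {x | s j₀ x = c j₀}) = 0) : m (Λ ∩ {x | ∀ j, s j x = c j}) = 0 := by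
  obtain ⟨j₀, hj₀⟩ := h
  exact measure_mono_null (inter_subset_inter_right _ fun x hx => hx j₀) hj₀

/-- **PUSH-FORWARD ALONG A MEASURABLE LINE**: `(μ.map ℓ) {x | s x = c} ≤ μ {t | s (ℓ t) = c}`-type transfer: if `μ {t | s (ℓ t) = c} = 0` then `(μ.map ℓ) (Λ ∩ {s = c}) = 0` for every `Λ`
(no measurability of the level set needed: `Measure.map_apply_le`∕outer measure via a measurable null superset is avoided by `map_mono_null`-style reasoning on the preimage). [folklore] -/
theorem map_levelSet_eq_zero {T X : Type*} [MeasurableSpace T] [MeasurableSpace X] (μ : Measure T) {ℓ : T → X} (hℓ : Measurable ℓ) (s : X → ℂ) (hsm : Measurable s) (c : ℂ)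
    (h : μ {t | s (ℓ t) = c} = 0) (Λ : Set X) : (μ.map ℓ) (Λ ∩ {x | s x = c}) = 0 := by
  refine measure_mono_null inter_subset_right ?_
  change (Measure.map ℓ μ) (s ⁻¹' {c}) = 0
  rw [Measure.map_apply hℓ (hsm (measurableSet_singleton c))]
  exact h

/-- **COUNTABLY MANY LINES** (`Measure.sum`): a set null for every summand is null for the sum (Mathlib `Measure.sum_apply_eq_zero`). [folklore] -/
theorem sum_levelSet_eq_zero {X : Type*} [MeasurableSpace X] {ι : Type*} [Countable ι] (μ : ι → Measure X) (S : Set X) (h : ∀ i, μ i S = 0) :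
    Measure.sum μ S = 0 :=
  Measure.sum_apply_eq_zero.2 h

end Summit.HodgeConjecture.HodgeConjecture.Cruxes.H413.K2E1AnalyticLevelSetNullU

end
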